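import Summits.HubbardSuperconductivity.HubbardSuperconductivity.Theorems.ThermalWedgeTwTipContinuationEdgeOrderBCSExpectations
import Summits.HubbardSuperconductivity.HubbardSuperconductivity.Theorems.ThermalWedgeTwTipContinuationEdgeOrderSectors
import Summits.HubbardSuperconductivity.HubbardSuperconductivity.Theorems.TwTipContinuation.Negative.SeededChords
import Literature.MathematicalPhysics.QuantumLattice.HubbardFreeCovariance
import Literature.MathematicalPhysics.QuantumLattice.TorusCooperSum

/-!
# `TwTipContinuation` (stmt-HubbardSuperconductivity-1700) — weak-coupling darkness, piece 3a:
# the Slater-determinant upper bound on the free canonical sector energy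

For the free torus `H₀ = hubbardTorus 2 L 1 0 = Σ_{kσ} ε_L(k) n_{kσ}` (`L ≥ 3`) and ANY finite set
`F ⊆ (ℤ/Lℤ)²` of momenta, the sector energy in the sector `(2|F|, S^z = 0)` satisfies

  `E₀(2|F|) ≤ 2 Σ_{k ∈ F} ε_L(k)`      (`freeSectorEnergy_le_twice_sum`)

— test `H₀` on the Slater determinant `Π_{k∈F} c†_{k↑} c†_{-k↓} |0⟩`, written as the BCS product
vector of `ThermalWedgeTwTipContinuationEdgeOrderProductState` with `0/1` coefficients
(`v = 𝟙_F`, `u = 1 - 𝟙_F`, kept as hypotheses `u² + v² = 1`, `v² = 𝟙_F` on general real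
coefficients): it is normalised, has `⟨N⟩ = 2|F|` and number variance
`Σ_k 4v_k²(1 - v_k²) = 0`, so all its sector weight sits in the sector `(|F|,|F|)`
(`variance_totalNumber_eq_sum_sectors`), and its kinetic energy is `Σ_k ε_k (v_k² + v_{-k}²) = 2Σ_F ε_k`
(`expect_oneBody_prodState`, `ε_{-k} = ε_k`). With the level-filling lower bound
`freeSectorEnergy_ge` of the line `isogap-submodular-transport` this pins the free sector energy to
the Fermi-sea value at every Fermi set `F` (piece 3b, `…WeakCouplingDarknessKinetic.lean`).
Textbook (Fetter–Walecka, *Quantum Theory of Many-Particle Systems* (1971) §2). [folklore]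
-/

noncomputable section

namespace Summit.HubbardSuperconductivity.TwTipContinuation.WeakCouplingDarkness

open Matrix Finset
open Literature.MathematicalPhysics.QuantumLattice Literature.Probability.LatticeModels
open Summit.HubbardSuperconductivity.TwTipContinuation.IsogapTransport
open Summit.HubbardSuperconductivity.TwTipContinuation.Negative
open scoped ComplexOrder ComplexConjugate

variable {L : ℕ} [NeZero L]

/-- The Bogoliubov factor `u_k + v_k b†_k` (local notation for the literal matrix term, as in
`ThermalWedgeTwTipContinuationEdgeOrderProductState`). -/
local notation "bf[" u ", " v "] " k:max =>
  (((u k : ℝ) : ℂ) • (1 : Matrix (Finset (Orb (FermionTorus 2 _))) (Finset (Orb (FermionTorus 2 _))) ℂ) +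
    ((v k : ℝ) : ℂ) • (pairMode k)ᴴ)

/-- The product vector `Ψ_l = Π_{k ∈ l} (u_k + v_k b†_k) |0⟩` (local notation for the literal term). -/
local notation "Ψ[" u ", " v "] " l:max =>
  (List.prod (List.map (fun k => bf[u, v] k) l) *ᵥ (vacuum : Fock (Orb (FermionTorus 2 _))))

/-! ### `0/1` coefficients of a Slater determinant -/

variable {u v : TorusSite 2 L → ℝ} {F : Finset (TorusSite 2 L)}

omit [NeZero L] in
/-- `v_k⁴ = v_k²` for `0/1`-valued `v_k²`. [folklore] -/
theorem pow_four_eq_sq_of_indicator (hv : ∀ k, v k ^ 2 = if k ∈ F then 1 else 0) (k : TorusSite 2 L) :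
    v k ^ 4 = v k ^ 2 := by
  have h := hv k
  have h4 : v k ^ 4 = (v k ^ 2) ^ 2 := by ring
  rw [h4, h]
  split_ifs <;> norm_num

/-- `Σ_k 2 v_k² = 2|F|` for `v_k² = 𝟙_F(k)`. [folklore] -/
theorem sum_two_mul_sq_of_indicator (hv : ∀ k, v k ^ 2 = if k ∈ F then 1 else 0) :
    ∑ k : TorusSite 2 L, 2 * v k ^ 2 = 2 * (F.card : ℝ) := by
  simp only [hv, ← Finset.mul_sum]
  rw [Finset.sum_ite_mem, Finset.univ_inter, Finset.sum_const, nsmul_eq_mul, mul_one]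

/-! ### The Slater determinant sits in one sector -/

/-- **All the sector weight of the `0/1` product vector sits in the sector `(|F|, |F|)`**: for
`m ≠ |F|` the component `Ψ_m` vanishes in norm (zero number variance). [folklore] -/
theorem slater_weight_eq_zero (huv : ∀ k, u k ^ 2 + v k ^ 2 = 1)
    (hv : ∀ k, v k ^ 2 = if k ∈ F then 1 else 0) {m : ℕ}
    (hm : m ∈ Finset.range (Fintype.card (FermionTorus 2 L) + 1)) (hmn : m ≠ F.card) :
    (star (sectorProj m m (Ψ[u, v] (Finset.univ : Finset (TorusSite 2 L)).toList)) ⬝ᵥ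
      sectorProj m m (Ψ[u, v] (Finset.univ : Finset (TorusSite 2 L)).toList)).re = 0 := by
  have hbal : Ψ[u, v] (Finset.univ : Finset (TorusSite 2 L)).toList ∈ spinBalanced :=
    prodState_mem_spinBalanced _ _ _
  have hvar := variance_totalNumber_prodState u v huv
  have hsec := variance_totalNumber_eq_sum_sectors hbal (∑ k : TorusSite 2 L, 2 * v k ^ 2)
  rw [hvar, Complex.ofReal_re] at hsec
  -- the variance vanishes
  have hvan : ∑ k : TorusSite 2 L, (4 * v k ^ 2 - 4 * v k ^ 4) = 0 :=
    Finset.sum_eq_zero fun k _ => by rw [pow_four_eq_sq_of_indicator hv, sub_self]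
  rw [hvan] at hsec
  have hnonneg : ∀ m' ∈ Finset.range (Fintype.card (FermionTorus 2 L) + 1),
      0 ≤ (2 * m' - ∑ k : TorusSite 2 L, 2 * v k ^ 2) ^ 2 *
        (star (sectorProj m' m' (Ψ[u, v] (Finset.univ : Finset (TorusSite 2 L)).toList)) ⬝ᵥ
          sectorProj m' m' (Ψ[u, v] (Finset.univ : Finset (TorusSite 2 L)).toList)).re :=
    fun m' _ => mul_nonneg (sq_nonneg _) (weight_nonneg m' _)
  have hterm := (Finset.sum_eq_zero_iff_of_nonneg hnonneg).1 hsec.symm m hm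
  rw [sum_two_mul_sq_of_indicator hv] at hterm
  have hsq : (2 * (m : ℝ) - 2 * (F.card : ℝ)) ^ 2 ≠ 0 := by
    have : (2 * (m : ℝ) - 2 * (F.card : ℝ)) ≠ 0 := by
      intro h
      apply hmn
      have : (m : ℝ) = F.card := by linarith
      exact_mod_cast this
    positivity
  exact (mul_eq_zero.1 hterm).resolve_left hsq

/-- The weight of the `0/1` product vector in its own sector `(|F|, |F|)` is `1`. [folklore] -/
theorem slater_weight_card_eq_one (huv : ∀ k, u k ^ 2 + v k ^ 2 = 1)
    (hv : ∀ k, v k ^ 2 = if k ∈ F then 1 else 0) :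
    (star (sectorProj F.card F.card (Ψ[u, v] (Finset.univ : Finset (TorusSite 2 L)).toList)) ⬝ᵥ
      sectorProj F.card F.card (Ψ[u, v] (Finset.univ : Finset (TorusSite 2 L)).toList)).re = 1 := by
  have hbal : Ψ[u, v] (Finset.univ : Finset (TorusSite 2 L)).toList ∈ spinBalanced :=
    prodState_mem_spinBalanced _ _ _
  have hnorm : star (Ψ[u, v] (Finset.univ : Finset (TorusSite 2 L)).toList) ⬝ᵥ
      Ψ[u, v] (Finset.univ : Finset (TorusSite 2 L)).toList = 1 :=
    star_prodState_dotProduct_self u v huv (Finset.nodup_toList _)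
  have hsum := sum_weights_eq hbal
  rw [hnorm, Complex.one_re] at hsum
  have hmem : F.card ∈ Finset.range (Fintype.card (FermionTorus 2 L) + 1) := by
    rw [Finset.mem_range, Nat.lt_succ_iff, Summit.HubbardSuperconductivity.NoGo.card_fermionTorus_two,
      ← card_torusSite_two L]
    exact Finset.card_le_univ F
  rw [Finset.sum_eq_single_of_mem F.card hmem (fun m hm hmn => slater_weight_eq_zero huv hv hm hmn)] at hsum
  exact hsum

/-! ### The kinetic energy of the Slater determinant -/

/-- `re⟨Ψ_F, H₀ Ψ_F⟩ = 2 Σ_{k∈F} ε_L(k)` (`L ≥ 3`; `ε_{-k} = ε_k`). [folklore] -/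
theorem slater_kinetic (hL : 3 ≤ L) (huv : ∀ k, u k ^ 2 + v k ^ 2 = 1)
    (hv : ∀ k, v k ^ 2 = if k ∈ F then 1 else 0) :
    (star (Ψ[u, v] (Finset.univ : Finset (TorusSite 2 L)).toList) ⬝ᵥ
      (hubbardTorus 2 L 1 0 *ᵥ Ψ[u, v] (Finset.univ : Finset (TorusSite 2 L)).toList)).re =
      2 * ∑ k ∈ F, torusBand L k := by
  rw [hubbardTorus_zero_eq_sum_momentumNumber hL,
    expect_oneBody_prodState u v huv (torusBand L), Complex.ofReal_re]
  have hneg : ∑ k : TorusSite 2 L, torusBand L k * v (-k) ^ 2 =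
      ∑ k : TorusSite 2 L, torusBand L k * v k ^ 2 := by
    rw [← Equiv.sum_comp (Equiv.neg (TorusSite 2 L)) (fun k => torusBand L k * v (-k) ^ 2)]
    refine Finset.sum_congr rfl fun k _ => ?_
    simp only [Equiv.neg_apply, neg_neg, torusBand_neg]
  have hsplit : ∑ k : TorusSite 2 L, torusBand L k * (v k ^ 2 + v (-k) ^ 2) =
      2 * ∑ k : TorusSite 2 L, torusBand L k * v k ^ 2 := by
    simp only [mul_add, Finset.sum_add_distrib]
    rw [hneg, two_mul]
  have hF : ∑ k : TorusSite 2 L, torusBand L k * v k ^ 2 = ∑ k ∈ F, torusBand L k := by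
    simp only [hv, mul_ite, mul_one, mul_zero]
    rw [Finset.sum_ite_mem, Finset.univ_inter]
  rw [hsplit, hF]

/-! ### The Slater bound -/

/-- **Slater-determinant upper bound on the free sector energy (piece 3a of the weak-coupling
darkness bound for `TwTipContinuation`).** For `L ≥ 3` and every finite set `F` of momenta,
`minEnergyOn (hubbardTorus 2 L 1 0) (szSector (2|F|) 0) ≤ 2 Σ_{k∈F} ε_L(k)`. [folklore] -/
theorem freeSectorEnergy_le_twice_sum (hL : 3 ≤ L) (F : Finset (TorusSite 2 L)) :
    Matrix.minEnergyOn (hubbardTorus 2 L 1 0) (szSector (2 * F.card) 0) ≤ 2 * ∑ k ∈ F, torusBand L k := by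
  classical
  -- the `0/1` coefficients `u = 1 - 𝟙_F`, `v = 𝟙_F`
  have huv : ∀ k, (fun k => if k ∈ F then (0 : ℝ) else 1) k ^ 2 + (fun k => if k ∈ F then (1 : ℝ) else 0) k ^ 2 = 1 := by
    intro k; simp only; split_ifs <;> norm_num
  have hv : ∀ k, (fun k => if k ∈ F then (1 : ℝ) else 0) k ^ 2 = if k ∈ F then 1 else 0 := by
    intro k; simp only; split_ifs <;> norm_num
  have hbal : Ψ[(fun k => if k ∈ F then (0 : ℝ) else 1), (fun k => if k ∈ F then (1 : ℝ) else 0)]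
      (Finset.univ : Finset (TorusSite 2 L)).toList ∈ spinBalanced :=
    prodState_mem_spinBalanced _ _ _
  have hH : PreservesSectors (hubbardTorus 2 L 1 0) := by
    have h := preservesSectors_seededH 0 0 L
    rwa [seededH_zero] at h
  -- sector-wise Rayleigh lower bounds by the sector energies themselves
  have hGle : ∀ m ∈ Finset.range (Fintype.card (FermionTorus 2 L) + 1),
      ∀ φ ∈ szSector (Λ := FermionTorus 2 L) (2 * m) (0 : ℝ), star φ ⬝ᵥ φ = 1 →
        (fun m => Matrix.minEnergyOn (hubbardTorus 2 L 1 0) (szSector (Λ := FermionTorus 2 L) (2 * m) 0)) m ≤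
          (star φ ⬝ᵥ (hubbardTorus 2 L 1 0 *ᵥ φ)).re := by
    intro m hm φ hφ hφ1
    have hmc : m ≤ Fintype.card (FermionTorus 2 L) := Nat.lt_succ_iff.1 (Finset.mem_range.1 hm)
    have h := (seeded_sector_groundState 0 0 L hmc).2 φ hφ hφ1
    rw [seededH_zero] at h
    exact h
  have hvar := sum_weight_mul_le_expect hH hbal _ hGle
  have hmem : F.card ∈ Finset.range (Fintype.card (FermionTorus 2 L) + 1) := by
    rw [Finset.mem_range, Nat.lt_succ_iff, Summit.HubbardSuperconductivity.NoGo.card_fermionTorus_two,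
      ← card_torusSite_two L]
    exact Finset.card_le_univ F
  rw [Finset.sum_eq_single_of_mem F.card hmem (fun m hm hmn => by
      rw [slater_weight_eq_zero huv hv hm hmn, mul_zero]), slater_weight_card_eq_one huv hv, mul_one,
    slater_kinetic hL huv hv] at hvar
  exact hvar

/-- **Slater-determinant upper bound on the free canonical sector energy (piece 3a of the
weak-coupling darkness bound for `TwTipContinuation`)**, closed form: for `L ≥ 3` and every
finite set `F` of torus momenta, `E₀(2|F|) ≤ 2 Σ_{k∈F} ε_L(k)` for the pure `U = 0` torus in the
sector `(2|F|, S^z = 0)`. [folklore] -/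
theorem freeSectorEnergy_le_slater :
    ∀ (L : ℕ) [NeZero L], 3 ≤ L → ∀ F : Finset (TorusSite 2 L), Matrix.minEnergyOn (hubbardTorus 2 L 1 0) (szSector (2 * F.card) 0) ≤ 2 * ∑ k ∈ F, torusBand L k :=
  fun _ _ hL F => freeSectorEnergy_le_twice_sum hL F

end Summit.HubbardSuperconductivity.TwTipContinuation.WeakCouplingDarkness
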